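import Literature.MathematicalPhysics.QuantumFieldTheory.Balaban1983to89.B9GeoLemma21KLevelV1
import Literature.MathematicalPhysics.QuantumFieldTheory.Balaban1983to89.B9RWSums347DefiniteFaces

/-!
# `Balaban1983to89.B9GeoInputsMultiRateKLevelV1` — [Balaban1984PropagatorsII] LEMMA 2.1 (2.61)/(2.63) p. 234 AT SEVERAL RATE PAIRS UNDER ONE M-THRESHOLD,
# WITH A COMMON EXPONENT, and the p. 398 [Balaban1985BackgroundPropagators] SCALE TRANSFERS for the weights `(Lʲη)²` and `(Lʲη)⁻⁴` under explicit size
# conditions — the geometric inputs of the G-B9-LETTERS random-walk assemblies (M5.5 / M5.6) on the k-level V1 reading `geo9K` (cell `lit-balaban`, module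
# M5.6 FILE 11, seat p21 gen 33)

statement-level skeleton of published theorems with citation tags; proofs where landed; nothing here is a claim about the Yang–Mills mass gap

CITATION HEADER (lean-in-tree rule).  [4] = T. Bałaban, *Propagators and renormalization transformations for lattice gauge theories. II*, Commun. Math. Phys.
**96** (1984) 223–250 [Balaban1984PropagatorsII]: Lemma 2.1 p. 234 «sup_{y∈𝔅} Σ_{y′∈𝔅} e^{−αδ₀d(y,y′)} ≦ c₁(α), (2.61) … c₁(α) = 12c₀ᵈ(½α)», (2.59) p. 233 (the size
condition «for RM satisfying (2.59)»), (2.60) p. 234, (2.63) p. 234, (2.54) p. 233.  B9 = T. Bałaban, *Propagators for lattice gauge theories in a background field*,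
Commun. Math. Phys. **99** (1985) 389–434 [Balaban1985BackgroundPropagators]: p. 398, remark after (3.47): «Using Lemma 2.1 in [4] we may replace the factor
(Lʲη)^α by (Lʲη)^β(L^{j′}η)^γ with β + γ = α»; p. 413 Theorem 3.9 «For M sufficiently large».  Rows B4.Lem2.1 × B9.Thm3.9 (cells only; no row head changes).

WHY THIS FILE.  The M5.6 end-to-end statements (`B9Thm39CinvFinalLoc`, `B9Thm39CinvAtCover`) display [4] Lemma 2.1 for the member at THREE rate pairs —
`((1−α_G)δ_G, α₂)` (Theorem 3.1's blocks of `G′²`), `(δ₀, b−ρ)` (the inner compositions of (2.83)–(2.85)) and `(ρδ₀, α′)` (the final (2.66) resummation), the last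
two at ONE common exponent `d′` — and the two p. 398 scale transfers of `ℓ²` and `ℓ⁻⁴`.  The tree discharges ONE pair at a time above an existential threshold
(`B9Thm37GpTorusRegular.geo_inputs_geo9K`, `B9RWSums347DefiniteFaces.ineq261_exp261_of_rowSum261`, exponent `exp261 geo9K δ α` BY CHOICE) and the transfers at real
powers (`B9GeoLemma21KLevelV1.transferL_geo9K`).  THIS FILE packages exactly what the assemblies consume: (2.61) is MONOTONE in the exponent (`c₁ = 12c₀ᵈ(½α)`,
`c₀ ≧ 1`), so two pairs share the exponent `max` of their doors; three pairs hold under the `max` of three thresholds; (2.63) follows by pv08's «hence»; the transfers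
for the natural-power weights `(Lʲη)²`, `(Lʲη)⁻⁴` hold with the constants `L²`, `L⁴` under the printed-type size conditions `2·log L ≦ αδ(2L²−1)M`, `4·log L ≦ αδ(2L²−1)M`.

WHAT IS PROVED (all `theorem`s, 0 `def`, 0 sorry, 0 new named facts).
* §1 `c1_mono_exp`, `ineq261_mono_exp` — `c₁(d, δ₀, α) ≦ c₁(d″, δ₀, α)` and `Ineq261 d ⇒ Ineq261 d″` for `d ≦ d″` (`αδ₀ > 0`).
* §2 ★ `ineq261_three_geo9K` — for three rate pairs with positive products: `∃ M_L, ∀ i, M_L ≦ M_i →` (2.61) at pair 1 with exponent `exp261 geo9K δ₁ α₁` and at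
  pairs 2, 3 with the COMMON exponent `max (exp261 geo9K δ₂ α₂) (exp261 geo9K δ₃ α₃)`; ★ `geo_inputs3_geo9K` — the same plus (2.63) at pair 3 (`0 ≦ δ₃`, `α₃ ≦ 1`),
  (2.54), `d(y,y) = 0`, symmetry and `d ≧ 0` (the full geometric binder list of `B9Thm39CinvAtCover.hasMajorant_conj_XinvY_of_eBlockInv_cover`).
* §3 ★ `scaleTransfer_len_sq_geo9K` (`e^{−αδd(y,y′)}(L^{j′}η)² ≦ L²(Lʲη)²` under `2·log L ≦ αδ(2L²−1)M`), ★ `scaleTransfer_len_inv4_geo9K`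
  (`e^{−αδd(y,y′)}(L^{j′}η)⁻⁴ ≦ L⁴(Lʲη)⁻⁴` under `4·log L ≦ αδ(2L²−1)M`) — fixed member, explicit size conditions, no threshold to choose.

HONEST SCOPE / NOT CLAIMED.  Pure repackaging of kernel-checked geometry of the reading of record (`rowSum261_geo9K`, `ineq260_geo9K` through `transferL_geo9K`);
the (2.61) thresholds stay EXISTENTIAL (the cell's door construction `exp261`/`rowConst261` is by choice — no numerical `M` is asserted); the printed constant
`c₁(α) = 12c₀ᵈ(½α)` enters only as an `α`-dependent O(1) at the door exponent (cell record on the printed `d`: GAPS G-A11-1/G-A12-1, `B6.c1` docstring).  Finite 𝕋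
members of the k-level V1 family; nothing continuum, nothing about the mass gap; NOT summit progress.  RELATED, NOT DUPLICATED: `B9Thm37GpTorusRegular.geo_inputs_geo9K`
(one pair), `B9RWSums347DefiniteFaces.ineq261_exp261_pair_of_rowSum261` (two pairs, two exponents), `B9RWSums347DefiniteFacesWindow.scaleTransfer_rpow_window_geo9Y`
(real powers at def-Y's `geo9Y`, window form).  Searched 2026-08-28: `lean search 'GeoInputsMultiRate|ineq261_mono|scaleTransfer_len_sq_geo9K' --decl` = ∅.
-/

noncomputable section

namespace Literature.MathematicalPhysics.QuantumFieldTheory.Balaban1983to89.B9GeoInputsMultiRateKLevelV1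

open B6KLevelCensusIndexV1 (KIdx)
open B6RandomWalk (Ineq261 Ineq263 Triangle254)
open B9Thm34Ext (toB6)
open B9GeoNormsKLevelV1 (geo9K)
open B9RWSums347DefiniteFaces (exp261 ineq261_exp261_of_rowSum261)
open B9GeoLemma21KLevelV1 (rowSum261_geo9K transferL_geo9K geo9K_dist_triangle geo9K_dist_self geo9K_dist_comm geo9K_dist_nonneg' geo9K_one_le_L
  geo9K_len_pos geo9K_M_nonneg)
open B9Ineq347 (ScaleTransfer)

variable {d ℓ : ℕ} {hd : 1 ≤ d + 1} {hL : Odd (ℓ + 1) ∧ 1 < ℓ + 1} {b₀ b₁ : ℝ}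

/-! ## §1 (2.61) is monotone in the exponent -/

/-- **`c₁` is monotone in the exponent**: `c₁(d, δ₀, α) = 12c₀(½α)ᵈ ≦ 12c₀(½α)^{d″}` for `d ≦ d″`, since `c₀(½α) ≧ 1` (`αδ₀ > 0`).
[cite: Balaban1984PropagatorsII, Lemma 2.1 p.234 («c₁(α) = 12c₀ᵈ(½α)»), p.233 (c₀), bookkeeping] -/
theorem c1_mono_exp {δ₀ α : ℝ} (h : 0 < α * δ₀) {d₁ d₂ : ℕ} (hd : d₁ ≤ d₂) : B6.c1 d₁ δ₀ α ≤ B6.c1 d₂ δ₀ α := by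
  unfold B6.c1
  have h2 : 0 < α / 2 * δ₀ := by rw [div_mul_eq_mul_div]; exact div_pos h two_pos
  have h1 : 1 ≤ B6.c0 δ₀ (α / 2) := B6Lemma21Arith.one_le_c0 h2
  exact mul_le_mul_of_nonneg_left (pow_le_pow_right₀ h1 hd) (by norm_num)

/-- **(2.61) is monotone in the exponent**: `Ineq261 d ⇒ Ineq261 d″` for `d ≦ d″` (`αδ₀ > 0`). [cite: Balaban1984PropagatorsII, Lemma 2.1 (2.61) p.234, bookkeeping] -/
theorem ineq261_mono_exp {g : B6.Geometry} {δ₀ α : ℝ} (h : 0 < α * δ₀) {d₁ d₂ : ℕ} (hd : d₁ ≤ d₂) (h261 : Ineq261 d₁ g δ₀ α) : Ineq261 d₂ g δ₀ α :=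
  fun y => (h261 y).trans (c1_mono_exp h hd)

/-! ## §2 Three rate pairs under one threshold; the geometric binder list of the M5.6 assembly -/

section Family

variable [∀ i : KIdx d ℓ hd hL b₀ b₁, Fintype (geo9K i).Site]

/-- ★ **[4] LEMMA 2.1 (2.61) AT THREE RATE PAIRS UNDER ONE THRESHOLD, PAIRS 2 AND 3 AT A COMMON EXPONENT** («for RM satisfying (2.59)»): for positive products
`α₁δ₁, α₂δ₂, α₃δ₃` there is `M_L` such that every member of the k-level V1 family with `M_L ≦ M` satisfies (2.61) at `(δ₁, α₁)` with the door exponent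
`exp261 geo9K δ₁ α₁` and at `(δ₂, α₂)`, `(δ₃, α₃)` with the common exponent `max (exp261 geo9K δ₂ α₂) (exp261 geo9K δ₃ α₃)`, for ANY transport letters `Rr`, `Hp`.
[cite: Balaban1984PropagatorsII, Lemma 2.1 (2.61) p.234 + (2.59) p.233] -/
theorem ineq261_three_geo9K (Rr : KIdx d ℓ hd hL b₀ b₁ → ℝ) (Hp : KIdx d ℓ hd hL b₀ b₁ → Prop) {δ₁ α₁ δ₂ α₂ δ₃ α₃ : ℝ}
    (h₁ : 0 < α₁ * δ₁) (h₂ : 0 < α₂ * δ₂) (h₃ : 0 < α₃ * δ₃) :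
    ∃ ML : ℝ, ∀ i : KIdx d ℓ hd hL b₀ b₁, ML ≤ (geo9K i).M →
      Ineq261 (exp261 (geo9K (d := d) (ℓ := ℓ) (hd := hd) (hL := hL) (b₀ := b₀) (b₁ := b₁)) δ₁ α₁) (toB6 (geo9K i) (Rr i) (Hp i)) δ₁ α₁ ∧
      Ineq261 (max (exp261 (geo9K (d := d) (ℓ := ℓ) (hd := hd) (hL := hL) (b₀ := b₀) (b₁ := b₁)) δ₂ α₂)
        (exp261 (geo9K (d := d) (ℓ := ℓ) (hd := hd) (hL := hL) (b₀ := b₀) (b₁ := b₁)) δ₃ α₃)) (toB6 (geo9K i) (Rr i) (Hp i)) δ₂ α₂ ∧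
      Ineq261 (max (exp261 (geo9K (d := d) (ℓ := ℓ) (hd := hd) (hL := hL) (b₀ := b₀) (b₁ := b₁)) δ₂ α₂)
        (exp261 (geo9K (d := d) (ℓ := ℓ) (hd := hd) (hL := hL) (b₀ := b₀) (b₁ := b₁)) δ₃ α₃)) (toB6 (geo9K i) (Rr i) (Hp i)) δ₃ α₃ := by
  have hrow := rowSum261_geo9K (d := d) (ℓ := ℓ) (hd := hd) (hL := hL) (b₀ := b₀) (b₁ := b₁)
  obtain ⟨M₁, hM₁⟩ := ineq261_exp261_of_rowSum261 (geo := geo9K (d := d) (ℓ := ℓ) (hd := hd) (hL := hL) (b₀ := b₀) (b₁ := b₁)) Rr Hp h₁ hrow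
  obtain ⟨M₂, hM₂⟩ := ineq261_exp261_of_rowSum261 (geo := geo9K (d := d) (ℓ := ℓ) (hd := hd) (hL := hL) (b₀ := b₀) (b₁ := b₁)) Rr Hp h₂ hrow
  obtain ⟨M₃, hM₃⟩ := ineq261_exp261_of_rowSum261 (geo := geo9K (d := d) (ℓ := ℓ) (hd := hd) (hL := hL) (b₀ := b₀) (b₁ := b₁)) Rr Hp h₃ hrow
  refine ⟨max M₁ (max M₂ M₃), fun i hM => ⟨hM₁ i ((le_max_left _ _).trans hM), ?_, ?_⟩⟩
  · exact ineq261_mono_exp h₂ (le_max_left _ _) (hM₂ i (((le_max_left _ _).trans (le_max_right _ _)).trans hM))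
  · exact ineq261_mono_exp h₃ (le_max_right _ _) (hM₃ i (((le_max_right _ _).trans (le_max_right _ _)).trans hM))

/-- ★ **THE GEOMETRIC BINDERS OF THE M5.6 ASSEMBLY, ABOVE ONE THRESHOLD** (print: «For M sufficiently large»): for positive products `α₁δ₁, α₂δ₂, α₃δ₃` with
`0 ≦ δ₃`, `α₃ ≦ 1` there is `M_L` such that every member with `M_L ≦ M` has: (2.54), `d(y,y) = 0`, symmetry, `d ≧ 0`; (2.61) at pair 1 (exponent
`exp261 geo9K δ₁ α₁`); (2.61) at pairs 2 and 3 and (2.63) at pair 3, all at the common exponent `max (exp261 geo9K δ₂ α₂) (exp261 geo9K δ₃ α₃)` — the shapes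
`htri hrefl hsymm hdnn h261G h261b h261 h263` of `B9Thm39CinvAtCover.hasMajorant_conj_XinvY_of_eBlockInv_cover` with `(δ₁,α₁) = ((1−α_G)δ_G, α₂)`, `(δ₂,α₂) = (δ₀, b−ρ)`,
`(δ₃,α₃) = (ρδ₀, α′)`. [cite: Balaban1984PropagatorsII, Lemma 2.1 (2.61)/(2.63) p.234 + (2.54) p.233 + (2.59) p.233; Balaban1985BackgroundPropagators, Thm 3.9 p.413] -/
theorem geo_inputs3_geo9K (Rr : KIdx d ℓ hd hL b₀ b₁ → ℝ) (Hp : KIdx d ℓ hd hL b₀ b₁ → Prop) {δ₁ α₁ δ₂ α₂ δ₃ α₃ : ℝ}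
    (h₁ : 0 < α₁ * δ₁) (h₂ : 0 < α₂ * δ₂) (h₃ : 0 < α₃ * δ₃) (hδ₃ : 0 ≤ δ₃) (hα₃ : α₃ ≤ 1) :
    ∃ ML : ℝ, ∀ i : KIdx d ℓ hd hL b₀ b₁, ML ≤ (geo9K i).M →
      Triangle254 (toB6 (geo9K i) (Rr i) (Hp i)) ∧ (∀ y : (geo9K i).Site, (geo9K i).dist y y = 0) ∧
      (∀ a a' : (geo9K i).Site, (geo9K i).dist a a' = (geo9K i).dist a' a) ∧ (∀ a a' : (geo9K i).Site, 0 ≤ (geo9K i).dist a a') ∧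
      Ineq261 (exp261 (geo9K (d := d) (ℓ := ℓ) (hd := hd) (hL := hL) (b₀ := b₀) (b₁ := b₁)) δ₁ α₁) (toB6 (geo9K i) (Rr i) (Hp i)) δ₁ α₁ ∧
      Ineq261 (max (exp261 (geo9K (d := d) (ℓ := ℓ) (hd := hd) (hL := hL) (b₀ := b₀) (b₁ := b₁)) δ₂ α₂)
        (exp261 (geo9K (d := d) (ℓ := ℓ) (hd := hd) (hL := hL) (b₀ := b₀) (b₁ := b₁)) δ₃ α₃)) (toB6 (geo9K i) (Rr i) (Hp i)) δ₂ α₂ ∧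
      Ineq261 (max (exp261 (geo9K (d := d) (ℓ := ℓ) (hd := hd) (hL := hL) (b₀ := b₀) (b₁ := b₁)) δ₂ α₂)
        (exp261 (geo9K (d := d) (ℓ := ℓ) (hd := hd) (hL := hL) (b₀ := b₀) (b₁ := b₁)) δ₃ α₃)) (toB6 (geo9K i) (Rr i) (Hp i)) δ₃ α₃ ∧
      Ineq263 (max (exp261 (geo9K (d := d) (ℓ := ℓ) (hd := hd) (hL := hL) (b₀ := b₀) (b₁ := b₁)) δ₂ α₂)
        (exp261 (geo9K (d := d) (ℓ := ℓ) (hd := hd) (hL := hL) (b₀ := b₀) (b₁ := b₁)) δ₃ α₃)) (toB6 (geo9K i) (Rr i) (Hp i)) δ₃ α₃ := by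
  obtain ⟨ML, h⟩ := ineq261_three_geo9K Rr Hp h₁ h₂ h₃
  refine ⟨ML, fun i hM => ?_⟩
  obtain ⟨hA, hB, hC⟩ := h i hM
  have htri : Triangle254 (toB6 (geo9K i) (Rr i) (Hp i)) :=
    (B9Thm34Ext.triangle254_toB6_iff (geo9K i) (Rr i) (Hp i)).2 (geo9K_dist_triangle i)
  exact ⟨htri, geo9K_dist_self i, geo9K_dist_comm i, geo9K_dist_nonneg' i, hA, hB, hC,
    B9Thm34Ext.h263_of_h261 (geo9K i) (Rr i) (Hp i) _ δ₃ α₃ htri hδ₃ hα₃ hC⟩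

end Family

/-! ## §3 The p. 398 scale transfers for `(Lʲη)²` and `(Lʲη)⁻⁴` under explicit size conditions -/

section Transfer

variable (i : KIdx d ℓ hd hL b₀ b₁)

/-- `L = ℓ + 1` for the reading. [cite: Balaban1984PropagatorsII, (2.1) p.224, bookkeeping] -/
theorem geo9K_L_eq : (geo9K i).L = (ℓ : ℝ) + 1 := by
  show (((ℓ + 1 : ℕ) : ℝ)) = (ℓ : ℝ) + 1
  push_cast; ring

/-- ★ **SCALE TRANSFER FOR THE WEIGHT `(Lʲη)²`** («we may replace the factor (Lʲη)^α by (Lʲη)^β(L^{j′}η)^γ»): under the size condition `2·log L ≦ αδ(2L²−1)M`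
(`αδ > 0`), `e^{−αδd(y,y′)}(L^{j′}η)² ≦ L²(Lʲη)²` for all `y, y′` (`transferL_geo9K` at `q = 2`).
[cite: Balaban1985BackgroundPropagators, p.398 remark after (3.47); Balaban1984PropagatorsII, Lemma 2.1 (2.60) p.234] -/
theorem scaleTransfer_len_sq_geo9K {δ α : ℝ} (hε : 0 < α * δ)
    (hM : 2 * Real.log ((ℓ : ℝ) + 1) ≤ α * δ * (2 * ((ℓ : ℝ) + 1) ^ 2 - 1) * (geo9K i).M) :
    ScaleTransfer (geo9K i) δ α (((ℓ : ℝ) + 1) ^ 2) (fun a => (geo9K i).len a ^ 2) := by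
  have hq : |(2 : ℝ)| * Real.log (geo9K i).L ≤ α * δ * (2 * ((ℓ : ℝ) + 1) ^ 2 - 1) * (geo9K i).M := by
    rw [abs_of_pos two_pos, geo9K_L_eq]; exact hM
  have hT := transferL_geo9K i hε (2 : ℝ) hq
  have hL0 : 0 ≤ (geo9K i).L := zero_le_one.trans (geo9K_one_le_L i)
  have hC : (geo9K i).L ^ |(2 : ℝ)| = ((ℓ : ℝ) + 1) ^ 2 := by
    rw [abs_of_pos two_pos, Real.rpow_two, geo9K_L_eq]
  intro y y'
  have h := hT y y'
  rw [Real.rpow_two, Real.rpow_two, hC] at h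
  have hE : 0 < Real.exp (α * δ * (geo9K i).dist y y') := Real.exp_pos _
  rw [Real.exp_neg, inv_mul_le_iff₀ hE]
  calc (geo9K i).len y' ^ 2 ≤ ((ℓ : ℝ) + 1) ^ 2 * Real.exp (α * δ * (geo9K i).dist y y') * (geo9K i).len y ^ 2 := h
    _ = Real.exp (α * δ * (geo9K i).dist y y') * (((ℓ : ℝ) + 1) ^ 2 * (geo9K i).len y ^ 2) := by ring

/-- ★ **SCALE TRANSFER FOR THE WEIGHT `(Lʲη)⁻⁴`** (the (3.48) weight): under the size condition `4·log L ≦ αδ(2L²−1)M` (`αδ > 0`),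
`e^{−αδd(y,y′)}(L^{j′}η)⁻⁴ ≦ L⁴(Lʲη)⁻⁴` for all `y, y′` (`transferL_geo9K` at `q = −4`).
[cite: Balaban1985BackgroundPropagators, p.398 remark after (3.47) + Thm 3.2 (3.48) p.398; Balaban1984PropagatorsII, Lemma 2.1 (2.60) p.234] -/
theorem scaleTransfer_len_inv4_geo9K {δ α : ℝ} (hε : 0 < α * δ)
    (hM : 4 * Real.log ((ℓ : ℝ) + 1) ≤ α * δ * (2 * ((ℓ : ℝ) + 1) ^ 2 - 1) * (geo9K i).M) :
    ScaleTransfer (geo9K i) δ α (((ℓ : ℝ) + 1) ^ 4) (fun a => ((geo9K i).len a ^ 4)⁻¹) := by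
  have h4 : |(-4 : ℝ)| = 4 := by norm_num
  have hq : |(-4 : ℝ)| * Real.log (geo9K i).L ≤ α * δ * (2 * ((ℓ : ℝ) + 1) ^ 2 - 1) * (geo9K i).M := by
    rw [h4, geo9K_L_eq]; exact hM
  have hT := transferL_geo9K i hε (-4 : ℝ) hq
  have hC : (geo9K i).L ^ |(-4 : ℝ)| = ((ℓ : ℝ) + 1) ^ 4 := by
    rw [h4, geo9K_L_eq, show (4 : ℝ) = ((4 : ℕ) : ℝ) by norm_num, Real.rpow_natCast]
  have e : ∀ y : (geo9K i).Site, (geo9K i).len y ^ (-4 : ℝ) = ((geo9K i).len y ^ 4)⁻¹ := fun y => by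
    rw [Real.rpow_neg (geo9K_len_pos i y).le, show (4 : ℝ) = ((4 : ℕ) : ℝ) by norm_num, Real.rpow_natCast]
  intro y y'
  have h := hT y y'
  rw [e, e, hC] at h
  have hE : 0 < Real.exp (α * δ * (geo9K i).dist y y') := Real.exp_pos _
  rw [Real.exp_neg, inv_mul_le_iff₀ hE]
  calc ((geo9K i).len y' ^ 4)⁻¹ ≤ ((ℓ : ℝ) + 1) ^ 4 * Real.exp (α * δ * (geo9K i).dist y y') * ((geo9K i).len y ^ 4)⁻¹ := h
    _ = Real.exp (α * δ * (geo9K i).dist y y') * (((ℓ : ℝ) + 1) ^ 4 * ((geo9K i).len y ^ 4)⁻¹) := by ring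

end Transfer

end Literature.MathematicalPhysics.QuantumFieldTheory.Balaban1983to89.B9GeoInputsMultiRateKLevelV1

end
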